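import Summits.RiemannHypothesis.RiemannHypothesis.Theorems.Splittings.LiDescentCountingLaw
import HarnessLib

/-!
# The CLUSTER LAW for Li descents under RH (SketchG8 §5)

Cell rh-split, seat rh-split-li-bridge g8 (brief sha16 f79c5f09d8bcb036), card `run/shared/lean/pub/rh-split/cards/SPLIT-li-bridge.md` §15;
kernel source `HOME/rh-split-li-bridge/SketchG8.lean` sha16 7af98f60a743c35d (672 l, farm rc 0, std axioms), cut by the seat at the scratch's
section boundaries, decl text byte-verbatim; deltas = namespace `RhSplit.LiBridgeG8` ↦ `…Theorems.Splittings.LiDescentCountingLaw`, imports,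
module docstrings.  Tree inputs only: lane (xi)(c)–(f) (`LiLowZeroBudget.blockLaw_budget_clause`, `LiIncrHighPart.highPart_lower`,
`LiIncrBlockLawOfRH.lowSum_eq/reindex_nat/eventually_sqrt_log_le`, `LiIncrBlockLaw.TLi3.card_neg_mul_sq_le`, `LiIncrMeanSquare.MeanSquare.sum_sq_le'`),
Part Z (`LiDescentZeroPositiveLaw`), and the curvature band of `LiSecondOrderCriterion` (`liIncr_le_of_exception`).

This file: `card_separated_liDescent_le_of_rh` — RH ⟹ `∃ C ≥ 0, N₀, ∀ N ≥ N₀`: every set of descents `λ_{x+1} < λ_x`, `x ∈ [N, 2N)`, that is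
pairwise MORE than `2·W_N` apart, `W_N := log N/(20(2λ₁+1))`, has at most `C·N/(log N)³` elements (a descent at `x` drags `Δ_m ≤ 2λ₁|m − x|`
by `LiSecondOrderCriterion.liIncr_le_of_exception`, so the oscillatory part is `≤ −(log N)/20` on the `> W_N` block points within `W_N` of `x`;
disjoint windows against the block budget `Σ F² ≤ C·N` of `blockLaw_sharp_of_rh`); `liDescent_cluster_cover_of_rh` — RH ⟹ the descents of
`[N, 2N)` are covered by the `2W_N`-neighbourhoods of at most `C·N/(log N)³` of them (a maximal separated set).  RH-IMPLIED kernel estimates;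
certifies nothing about RH.

HONEST LABEL: «SPLITTING SEARCH over kernel-typed RH-EQUIVALENCES; a splitting A ∧ B ⟹ RH is CONDITIONAL bookkeeping unless A and B are
both proved; nothing here bears on the truth of RH.»
-/

set_option linter.dupNamespace false

noncomputable section

namespace Summit.RiemannHypothesis.RiemannHypothesis.Theorems.Splittings.LiDescentCountingLaw

open Filter Topology Finset
open Literature.NumberTheory.LFunctions Literature.NumberTheory.LFunctions.SchoenfeldBound
open Summit.RiemannHypothesis.RiemannHypothesis.Theorems.LiTheory
open Summit.RiemannHypothesis.RiemannHypothesis.Theorems.Splittings.LiLowZeroBudget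
  (ampM phase phase_mem fourteen_lt_im blockLaw_budget_clause)
open Summit.RiemannHypothesis.RiemannHypothesis.Theorems.Splittings.LiIncrMeanSquare.MeanSquare
  (dirichletBound sum_sq_le')
open Summit.RiemannHypothesis.RiemannHypothesis.Theorems.Splittings.LiIncrBlockLaw (TLi3.card_neg_mul_sq_le)
open Summit.RiemannHypothesis.RiemannHypothesis.Theorems.Splittings.LiIncrHighPart
  (liIncr highPart lowSum liIncr_eq_highPart_add_lowSum highPart_lower)
open Summit.RiemannHypothesis.RiemannHypothesis.Theorems.Splittings.LiIncrBlockLawOfRH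
  (reindex_nat lowSum_eq eventually_sqrt_log_le)
open Summit.RiemannHypothesis.RiemannHypothesis.Theorems.Splittings.LiDescentZeroPositiveLaw
  (rh_iff_liDescent_densityZero liDescent_lower_density_of_not_rh)
open Summit.RiemannHypothesis.RiemannHypothesis.Theorems.Splittings.LiSecondOrderCriterion
  (abs_liSecondDiff_le_of_rh liIncr_le_of_exception)

/-! ## §5 The CLUSTER LAW: RH ⟹ well-separated descents in `[N,2N)` number `O(N/(log N)³)` -/

/-- **THE CLUSTER LAW (RH ⟹).** Put `Λ = 2λ₁ + 1` and `W_N = log N/(20Λ)`. For `N ≥ N₀`, any set `S` of descents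
`λ_{x+1} < λ_x`, `x ∈ [N, 2N)`, which is pairwise MORE than `2·W_N` apart has `#S ≤ C·N/(log N)³`.
Equivalently (next theorem): the descents of a large dyadic block lie in at most `C·N/(log N)³` clusters of radius
`≤ 2W_N ≍ log N` — against the raw count `O(N/(log N)²)` of §2.  Proof: a descent at `x` drags the increments down
along a window — `Δ_m ≤ 2λ₁|m − x|` (tree `liIncr_le_of_exception`, from the curvature band `|d_n| ≤ 2λ₁`) — so the
oscillatory part `F = Δ − P ≤ −(log N)/20` on the `> W_N` block points within `W_N` of `x`; the windows of a
`2W_N`-separated set are disjoint, and the engine's mean-square budget `Σ_block F² ≤ C·N` pays `W_N·(log N)²/400`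
per window. -/
theorem card_separated_liDescent_le_of_rh (hRH : RiemannHypothesis) :
    ∃ C : ℝ, 0 ≤ C ∧ ∃ N₀ : ℕ, ∀ N : ℕ, N₀ ≤ N → ∀ S : Finset ℕ,
      (∀ x ∈ S, x ∈ Finset.Ico N (N + N) ∧ keiperLiCoeff (x + 1) < keiperLiCoeff x) →
      (∀ x ∈ S, ∀ y ∈ S, x ≠ y →
        2 * (Real.log N / (20 * (2 * keiperLiCoeff 1 + 1))) < |(x : ℝ) - y|) →
      (S.card : ℝ) ≤ C * N / Real.log N ^ 3 := by
  classical
  obtain ⟨C, hC0, N₀, hblk⟩ := blockLaw_sharp_of_rh hRH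
  have hlam : 0 ≤ 2 * keiperLiCoeff 1 :=
    (abs_nonneg _).trans (abs_liSecondDiff_le_of_rh hRH (n := 1) le_rfl)
  set Λ : ℝ := 2 * keiperLiCoeff 1 + 1 with hΛdef
  have hΛ1 : 1 ≤ Λ := by rw [hΛdef]; linarith
  have hΛ0 : 0 < Λ := by linarith
  refine ⟨8000 * Λ * C, mul_nonneg (mul_nonneg (by norm_num) hΛ0.le) hC0, N₀, fun N hN S hS hsep ↦ ?_⟩
  obtain ⟨hN2, s, a, θ, P, hθ, hdec, hP, hW⟩ := hblk N hN
  have hNr : (2 : ℝ) ≤ N := by exact_mod_cast hN2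
  have hN0 : (0 : ℝ) < N := by linarith
  have hlog : 0 < Real.log (N : ℝ) := Real.log_pos (by linarith)
  have hl0 : Real.log (N : ℝ) ≠ 0 := hlog.ne'
  have hΛne : Λ ≠ 0 := hΛ0.ne'
  have hlogle : Real.log (N : ℝ) ≤ N - 1 := Real.log_le_sub_one_of_pos hN0
  -- the oscillatory part and its mean square on the block
  set F : ℕ → ℝ := fun n ↦ ∑ j ∈ s, a j * Real.sin (((n : ℝ) + 1 / 2) * θ j) with hFdef
  have hF2 : ∑ n ∈ Finset.Ico N (N + N), F n ^ 2 ≤ C * N :=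
    (sum_sq_le' s a θ hθ N (M := N) (by omega)).trans hW
  -- the window radius
  set W : ℝ := Real.log N / (20 * Λ) with hWdef
  have hWpos : 0 < W := div_pos hlog (mul_pos (by norm_num) hΛ0)
  have hW0 : 0 ≤ W := hWpos.le
  have hWle : W ≤ Real.log N / 20 := by
    rw [hWdef]
    exact div_le_div_of_nonneg_left hlog.le (by norm_num) (by linarith)
  have hΛW : Λ * W = Real.log N / 20 := by
    rw [hWdef]; field_simp
  set w : ℕ := ⌊W⌋₊ with hwdef
  have hwW : (w : ℝ) ≤ W := Nat.floor_le hW0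
  have hWw : W < (w : ℝ) + 1 := Nat.lt_floor_add_one W
  have h2w : 2 * w + 1 ≤ N := by
    have : (2 * w + 1 : ℝ) ≤ N := by linarith
    exact_mod_cast this
  -- windows
  set win : ℕ → Finset ℕ := fun x ↦ (Finset.Ico N (N + N)).filter (fun m ↦ |(m : ℝ) - x| ≤ W)
    with hwindef
  -- (a) on the window of a descent, `F ≤ −(log N)/20`
  have hFwin : ∀ x ∈ S, ∀ m ∈ win x, (Real.log N / 20) ^ 2 ≤ F m ^ 2 := by
    intro x hx m hm
    obtain ⟨hxI, hxd⟩ := hS x hx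
    simp only [hwindef, Finset.mem_filter] at hm
    obtain ⟨hmI, hmx⟩ := hm
    have hx1 : 1 ≤ x := by rw [Finset.mem_Ico] at hxI; omega
    have hm1 : 1 ≤ m := by rw [Finset.mem_Ico] at hmI; omega
    have hexc : keiperLiCoeff (x + 1) - keiperLiCoeff x < 0 := by linarith
    have hlip := liIncr_le_of_exception hRH hx1 hm1 hexc
    have hΔ := hdec m hmI
    have hPm := hP m hmI
    have h1 : 2 * keiperLiCoeff 1 * |(m : ℝ) - x| ≤ Λ * W := by
      calc 2 * keiperLiCoeff 1 * |(m : ℝ) - x| ≤ Λ * |(m : ℝ) - x| :=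
            mul_le_mul_of_nonneg_right (by linarith) (abs_nonneg _)
        _ ≤ Λ * W := mul_le_mul_of_nonneg_left hmx hΛ0.le
    have hFeq : F m = (keiperLiCoeff (m + 1) - keiperLiCoeff m) - P m := by
      simp only [hFdef]; rw [hΔ]; ring
    have hFm : F m ≤ -(Real.log N / 20) := by rw [hFeq]; linarith
    have hc0 : 0 ≤ Real.log N / 20 := by positivity
    nlinarith
  -- (b) the windows of `S` are pairwise disjoint
  have hdisj : (S : Set ℕ).PairwiseDisjoint win := by
    intro x hx y hy hxy
    change Disjoint (win x) (win y)
    rw [Finset.disjoint_left]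
    intro m hmx hmy
    simp only [hwindef, Finset.mem_filter] at hmx hmy
    have h := hsep x (Finset.mem_coe.1 hx) y (Finset.mem_coe.1 hy) hxy
    have htri : |(x : ℝ) - y| ≤ |(m : ℝ) - x| + |(m : ℝ) - y| := by
      rw [← abs_neg ((m : ℝ) - x), neg_sub]
      exact abs_sub_le (x : ℝ) m y
    linarith [hmx.2, hmy.2]
  -- (c) each window has more than `W` block points
  have hcard : ∀ x ∈ S, W ≤ ((win x).card : ℝ) := by
    intro x hx
    obtain ⟨hxI, -⟩ := hS x hx
    rw [Finset.mem_Ico] at hxI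
    obtain ⟨hNx, hx2⟩ := hxI
    by_cases hright : x + w < N + N
    · have hsub : Finset.Icc x (x + w) ⊆ win x := by
        intro m hm
        rw [Finset.mem_Icc] at hm
        simp only [hwindef, Finset.mem_filter, Finset.mem_Ico]
        refine ⟨⟨by omega, by omega⟩, ?_⟩
        have h1 : (x : ℝ) ≤ m := by exact_mod_cast hm.1
        have h2 : (m : ℝ) ≤ x + w := by exact_mod_cast hm.2
        rw [abs_of_nonneg (by linarith)]
        linarith
      have hc := Finset.card_le_card hsub
      rw [Nat.card_Icc] at hc
      have hc' : ((x + w + 1 - x : ℕ) : ℝ) ≤ ((win x).card : ℝ) := by exact_mod_cast hc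
      rw [show x + w + 1 - x = w + 1 by omega] at hc'
      push_cast at hc'
      linarith
    · rw [not_lt] at hright
      have hxw : w ≤ x := by omega
      have hsub : Finset.Icc (x - w) x ⊆ win x := by
        intro m hm
        rw [Finset.mem_Icc] at hm
        simp only [hwindef, Finset.mem_filter, Finset.mem_Ico]
        refine ⟨⟨by omega, by omega⟩, ?_⟩
        have h1 : ((x - w : ℕ) : ℝ) ≤ m := by exact_mod_cast hm.1
        rw [Nat.cast_sub hxw] at h1
        have h2 : (m : ℝ) ≤ x := by exact_mod_cast hm.2
        rw [abs_of_nonpos (by linarith)]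
        linarith
      have hc := Finset.card_le_card hsub
      rw [Nat.card_Icc] at hc
      have hc' : ((x + 1 - (x - w) : ℕ) : ℝ) ≤ ((win x).card : ℝ) := by exact_mod_cast hc
      rw [show x + 1 - (x - w) = w + 1 by omega] at hc'
      push_cast at hc'
      linarith
  -- summation over the disjoint windows
  have hinner : ∀ x ∈ S, W * (Real.log N / 20) ^ 2 ≤ ∑ m ∈ win x, F m ^ 2 := by
    intro x hx
    have h1 := Finset.card_nsmul_le_sum (win x) (fun m ↦ F m ^ 2) ((Real.log N / 20) ^ 2)
      (fun m hm ↦ hFwin x hx m hm)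
    rw [nsmul_eq_mul] at h1
    exact (mul_le_mul_of_nonneg_right (hcard x hx) (by positivity)).trans h1
  have hsub : S.biUnion win ⊆ Finset.Ico N (N + N) :=
    Finset.biUnion_subset.2 fun x _ ↦ Finset.filter_subset _ _
  have htot : (S.card : ℝ) * (W * (Real.log N / 20) ^ 2) ≤ C * N :=
    calc (S.card : ℝ) * (W * (Real.log N / 20) ^ 2)
        = ∑ x ∈ S, W * (Real.log N / 20) ^ 2 := by rw [Finset.sum_const, nsmul_eq_mul]
      _ ≤ ∑ x ∈ S, ∑ m ∈ win x, F m ^ 2 := Finset.sum_le_sum hinner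
      _ = ∑ m ∈ S.biUnion win, F m ^ 2 := (Finset.sum_biUnion hdisj).symm
      _ ≤ ∑ m ∈ Finset.Ico N (N + N), F m ^ 2 :=
          Finset.sum_le_sum_of_subset_of_nonneg hsub fun m _ _ ↦ sq_nonneg _
      _ ≤ C * N := hF2
  -- conclusion: `#S ≤ C N / (W (log N)²/400) = 8000 Λ C N / (log N)³`
  have e : 8000 * Λ * C * N / Real.log N ^ 3 = C * N / (W * (Real.log N / 20) ^ 2) := by
    rw [hWdef, div_eq_div_iff (pow_ne_zero 3 hl0) (by positivity)]
    field_simp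
    ring
  rw [e, le_div_iff₀ (mul_pos hWpos (pow_pos (div_pos hlog (by norm_num)) 2))]
  exact htot

/-- **Covering form of the cluster law (RH ⟹).** For `N ≥ N₀` there is a set `T` of at most `C·N/(log N)³` descents of
the block `[N, 2N)` such that EVERY descent of the block lies within `2W_N = (log N)/(10(2λ₁+1))` of a member of `T`
(`T` = a `2W_N`-separated set of descents of maximal size). -/
theorem liDescent_cluster_cover_of_rh (hRH : RiemannHypothesis) :
    ∃ C : ℝ, 0 ≤ C ∧ ∃ N₀ : ℕ, ∀ N : ℕ, N₀ ≤ N → ∃ T : Finset ℕ,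
      (∀ x ∈ T, x ∈ Finset.Ico N (N + N) ∧ keiperLiCoeff (x + 1) < keiperLiCoeff x) ∧
      (T.card : ℝ) ≤ C * N / Real.log N ^ 3 ∧
      ∀ y ∈ Finset.Ico N (N + N), keiperLiCoeff (y + 1) < keiperLiCoeff y →
        ∃ x ∈ T, |(x : ℝ) - y| ≤ 2 * (Real.log N / (20 * (2 * keiperLiCoeff 1 + 1))) := by
  classical
  obtain ⟨C, hC0, N₀, h⟩ := card_separated_liDescent_le_of_rh hRH
  have hlam : 0 ≤ 2 * keiperLiCoeff 1 :=
    (abs_nonneg _).trans (abs_liSecondDiff_le_of_rh hRH (n := 1) le_rfl)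
  refine ⟨C, hC0, N₀, fun N hN ↦ ?_⟩
  set D : Finset ℕ := (Finset.Ico N (N + N)).filter (fun y ↦ keiperLiCoeff (y + 1) < keiperLiCoeff y)
    with hDdef
  set r : ℝ := 2 * (Real.log N / (20 * (2 * keiperLiCoeff 1 + 1))) with hrdef
  have hr0 : 0 ≤ r := by
    rw [hrdef]
    exact mul_nonneg (by norm_num) (div_nonneg (Real.log_natCast_nonneg N) (by linarith))
  -- the family of `r`-separated subsets of `D`; pick one of maximal cardinality
  set sep : Finset (Finset ℕ) := D.powerset.filter
    (fun S ↦ ∀ x ∈ S, ∀ y ∈ S, x ≠ y → r < |(x : ℝ) - y|) with hsepdef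
  have hne : sep.Nonempty :=
    ⟨∅, by simp only [hsepdef, Finset.mem_filter]; exact ⟨Finset.empty_mem_powerset _, by simp⟩⟩
  obtain ⟨T, hT, hTmax⟩ := Finset.exists_max_image sep Finset.card hne
  simp only [hsepdef, Finset.mem_filter, Finset.mem_powerset] at hT
  obtain ⟨hTD, hTsep⟩ := hT
  have hTD' : ∀ x ∈ T, x ∈ Finset.Ico N (N + N) ∧ keiperLiCoeff (x + 1) < keiperLiCoeff x := by
    intro x hx
    have := hTD hx
    simp only [hDdef, Finset.mem_filter] at this
    exact this
  refine ⟨T, hTD', h N hN T hTD' hTsep, fun y hy hyd ↦ ?_⟩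
  by_contra hfar
  push Not at hfar
  have hyD : y ∈ D := by simp only [hDdef, Finset.mem_filter]; exact ⟨hy, hyd⟩
  have hyT : y ∉ T := by
    intro hyT
    have := hfar y hyT
    simp only [sub_self, abs_zero] at this
    linarith
  -- `insert y T` is still separated and larger: contradiction with maximality
  have hins : insert y T ∈ sep := by
    simp only [hsepdef, Finset.mem_filter, Finset.mem_powerset]
    refine ⟨Finset.insert_subset hyD hTD, ?_⟩
    intro x hx z hz hxz
    rw [Finset.mem_insert] at hx hz
    rcases hx with rfl | hx <;> rcases hz with rfl | hz
    · exact absurd rfl hxz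
    · have := hfar z hz; rwa [abs_sub_comm] at this
    · exact hfar x hx
    · exact hTsep x hx z hz hxz
  have := hTmax (insert y T) hins
  rw [Finset.card_insert_of_notMem hyT] at this
  omega

end Summit.RiemannHypothesis.RiemannHypothesis.Theorems.Splittings.LiDescentCountingLaw
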